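import Summits.AtomisticToContinuum.BoseEinsteinCondensation.Theorems.BECGroundStateSOSPeriodicIRBoundTwoSectorKato
import Summits.AtomisticToContinuum.BoseEinsteinCondensation.Theorems.BECGroundStateSOSPeriodicIRBoundTwoSectorKLS
import Summits.AtomisticToContinuum.BoseEinsteinCondensation.Theorems.BECGroundStateSOSPeriodicIRBoundTwoSectorWindow
import HarnessLib

/-!
# Route `BECGroundStateSOS`, crux `PeriodicIRBound` (stmt-AtomisticToContinuum-3972), line `two-sector-gd-transfer` —
# the standing reduction after cycle 1: `GaussianDomination ∧ EnergyConvexityWindow ⇒` the integrable half of the crux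

With the line's own stubs S3 (`stub_katoSusceptibility`, p138476), S4 (`stub_klsNearMinimiser`, p138298) and S5 (`stub_windowAssembly`,
p138491) LANDED, the composition `integrableHalf_of` of the Defs module specialises to a reduction of the crux to the two POOLED items
alone: two-sector Gaussian domination `BECTwoSectorGD.GaussianDomination` (stmt-AtomisticToContinuum-12620) and midpoint near-convexity
`BECSectorPoincareTwoScale.EnergyConvexityWindow` (stmt-AtomisticToContinuum-9094) give the crux's infrared inequality `IRBoundFor v` for
every INTEGRABLE admissible `v` (`stub_integrableHalfOfPooled`); adding the scope half `NonIntegrableHalf` gives the crux for every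
admissible `v` (`stub_periodicIRBoundOfPooled`, the crux unfolded by `Negative.periodicIRBound_iff`). This is the third standing
reduction of `PeriodicIRBound` (next to `LinearPhFloorWagner.integrableClass_of_pooled`, stmt-9091 ∧ stmt-9094, and the
`FsumPhasePencil` reduction), registered on the crux ledger as by-product stubs of the line.
-/

noncomputable section

open scoped ENNReal
open MeasureTheory

namespace Summit.AtomisticToContinuum.BoseEinsteinCondensation.Cruxes.PeriodicIRBound.TwoSectorGdTransfer

open Literature.MathematicalPhysics.QuantumManyBody.BoseGas
open Summit.AtomisticToContinuum.BoseEinsteinCondensation.Theses.BECTwoSectorGD (GaussianDomination)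
open Summit.AtomisticToContinuum.BoseEinsteinCondensation.Theses.BECSectorPoincareTwoScale (EnergyConvexityWindow)
open Summit.AtomisticToContinuum.BoseEinsteinCondensation.Theorems.PeriodicIRBound.Negative (IRBoundFor periodicIRBound_iff_split)

/-- **Registered by-product stub `stub_integrableHalfOfPooled`**: two-sector Gaussian domination (stmt-12620) and midpoint
near-convexity (stmt-9094) give the crux's infrared inequality for every INTEGRABLE admissible pair potential — `integrableHalf_of`
with the landed S3, S4, S5. [folklore] -/
theorem stub_integrableHalfOfPooled :
    GaussianDomination → EnergyConvexityWindow →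
      ∀ v : ℝ → ℝ≥0∞, IsRepulsiveFiniteRange v → (∫⁻ x : Space, v ‖x‖) ≠ ⊤ → IRBoundFor v :=
  fun h1 h2 => integrableHalf_of h1 h2 stub_katoSusceptibility stub_klsNearMinimiser stub_windowAssembly

/-- **Registered by-product stub `stub_periodicIRBoundOfPooled`**: the two pooled items and the scope half `NonIntegrableHalf`
give the crux for EVERY admissible pair potential (the crux `PeriodicIRBound` unfolded by `Negative.periodicIRBound_iff`; split on
`∫ v = ⊤` by `Negative.periodicIRBound_iff_split`). [folklore] -/
theorem stub_periodicIRBoundOfPooled :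
    GaussianDomination → EnergyConvexityWindow → NonIntegrableHalf →
      ∀ v : ℝ → ℝ≥0∞, IsRepulsiveFiniteRange v → IRBoundFor v := by
  intro h1 h2 h6 v hv
  by_cases htop : (∫⁻ x : Space, v ‖x‖) = ⊤
  · exact h6 v hv htop
  · exact stub_integrableHalfOfPooled h1 h2 v hv htop

/-- The split used above is the landed one: the pair (integrable half, non-integrable half) is exactly `PeriodicIRBound`. -/
example (h1 : GaussianDomination) (h2 : EnergyConvexityWindow) (h6 : NonIntegrableHalf) :
    Summit.AtomisticToContinuum.BoseEinsteinCondensation.Theses.BECGroundStateSOS.PeriodicIRBound :=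
  periodicIRBound_iff_split.2 ⟨stub_integrableHalfOfPooled h1 h2, h6⟩

end Summit.AtomisticToContinuum.BoseEinsteinCondensation.Cruxes.PeriodicIRBound.TwoSectorGdTransfer

end
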